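import Summits.CriticalPhenomena.PercolationContinuityZ3.Theorems.FK.Transplant.KNFreeTargetStepV
import Summits.CriticalPhenomena.PercolationContinuityZ3.Theorems.FK.Transplant.KNFreeSeedsLevels
import Summits.CriticalPhenomena.PercolationContinuityZ3.Theorems.FK.Transplant.FKSetTargetGluing
import Summits.CriticalPhenomena.PercolationContinuityZ3.Theorems.FK.FreeEdwardsSokalTwoPoint
import HarnessLib

/-!
# FRONTIER TRANSPLANT, binder 2 (TP_FK) research line: Kozma–Nitzan's target Lemma 10 for the law of record
# `fkLaw Λ W q`, `q ≥ 1`, in the Bernoulli window, for `P_{p̃}`-hittable geometries (T2-window)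

Support file (`--supports stmt-CriticalPhenomena-4575`, helper) of the FRONTIER TRANSPLANT sub-cell
(`fk-continuity/transplant/`, seat `prim-bschramm-fkt-p3`); builds on p205010 (kernel theorem, internal audit signed;
external expert review pending). No definitions, no named facts, no sorries; standard axioms. Registered R55 (cell INBOX,
2026-08-22); lead label T2w (L13) — binder-2 WINDOW WITNESS leaf; registry row T2w.

HONEST FRAMING (page 1, cell rule). The transplant's theorem of record `ufsc0_of_freeBoundaryHypothesis_r3`
(p248245) is CONDITIONAL on FH AND on TP_FK = `KNFreeTargetHittable d q p`, both OPEN at the same `p` for `q > 1`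
(⇔ GRC Conj. (5.103) via K1; barrier note `Literature.Barriers.CriticalPhenomena.SamePFreeBoundaryCriteria`,
FBN-01, cited first); the transplant is a typed reduction, not a proof of FK continuity. THIS FILE proves, for
EVERY `q ≥ 1`, Kozma–Nitzan's Lemma 10 for the random-cluster law in the BERNOULLI WINDOW `θ(p̃) > 0`,
`p̃·q·(1-p) ≤ p·(1-p̃)` (e.g. `p̃ = p/(p+q(1-p))`), for geometries that are `P_{p̃}`-HITTABLE (tree `IsHittable p̃ g`):

* `fkTargetAt_of_isHittable_comparison` — `∀ ε > 0 ∃ δ > 0 ∀ H (∀ g ∈ H, IsHittable p̃ g) ∃ R, FKTargetAt d q p δ ε H R`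
  (`FKTargetAt` = the binder-2 matrix of FT-01: `φ(o ↔ B) > 1-δ ⟹ φ(o ↔ T) > 1-ε` for every finitely supported
  weighting with a lattice subbox `D ⊇ B⟨R⟩` at `p`, target `T` w.r.t. `(B, D, R, H)`, source `o ∉ D`,
  `φ = fkLaw Sfin W q`). Proof = KN pp. 17–22 with: Conjecture 3 ↦ the FK set-target gluing p243470 read through
  the lift (`fkLaw_setTarget_gluing_in`); Steps II–III ↦ the law-generic seeds engine with FK finite energy
  (`KNFree.exists_level_real_Gev_gt`, FT-03c); Step IV ↦ `stepIV_in_fkLaw_of_comparison` (looks under `P_{p̃}`: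
  Lemma 7 `exists_forall_le_lt_real_uniqZone`, Lemma 9 `exists_forall_lt_real_linked_orthantFace`, hittability at
  `p̃`); Step V ↦ `stepV_in_fkLaw` (exchange inequality).
* `fkTargetAt_of_isHittable_ratio` (`p̃ = p/(p+q(1-p))`), `fkTargetAt_qfList_of_theta_ratio_pos` (the quarter faces).

WHAT IT IS NOT: not `KNFreeTargetHittable d q p` (whose `H` range over FK(p,q)-hittable geometries; the gap is
exactly "`IsHittableFK q p g → IsHittable p̃ g`", false in general — a 2-dimensional sheet geometry hittable at
`(p,q)` need not be `P_{p̃}`-hittable — and a Peierls estimate for `p̃ ≥ p₁(d)`, the remaining package of the MEMO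
row T2-HD, R51); not `_r4`; no information at `p ↓ p_c(q)`; n_open = 2 unchanged.

## References

* G. Kozma, S. Nitzan, arXiv:2401.12397 (2024), §4 Lemma 9 (p. 16), Lemma 10 (pp. 17–22) [KozmaNitzan2024].
* G. Grimmett, *The Random-Cluster Model*, Springer 2006, §1.4 (1.20), Thm. (3.1) (3.4), Thm. (3.7), Thm. (3.21)
  eqs. (3.22)/(3.23), Conj. (5.103) [Grimmett2006].
-/

noncomputable section

open MeasureTheory
open scoped ENNReal Classical

namespace Summit.CriticalPhenomena.PercolationContinuityZ3.Theorems.FK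

open Literature.Probability.Percolation Literature.Probability.LatticeModels SimpleGraph
open Literature.Probability.Percolation.KozmaNitzan Transplant

variable {d : ℕ}

/-! ### Step I: the FK set-target gluing read through the lift (relays reliable inside a region suffice) -/

/-- `{o ↔ A}` read through the lift of the finite piece `Λ ∋ o`: the preimage of `⋃_{a ∈ A} {o ↔ a}` is
`⋃_{a' : ↥Λ, a' ∈ A} {⟨o⟩ ↔ a'}` (vertices of `A` outside `Λ` are unreachable: every open edge of a lift lies inside `Λ`).
[cite: Grimmett2006, §4.2 (configurations on E_Λ, extended by 0 off Λ)] -/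
theorem liftEdges_preimage_biUnion_openConn (Λ : Finset (Site d)) {o : Site d} (ho : o ∈ Λ) (A : Finset (Site d)) :
    liftEdges Λ ⁻¹' (⋃ a ∈ A, openConn o a) =
      ⋃ a' ∈ {a' : ↥Λ | (a' : Site d) ∈ A}, openConn (⟨o, ho⟩ : ↥Λ) a' := by
  ext ω
  simp only [Set.mem_preimage, Set.mem_iUnion, Set.mem_setOf_eq, exists_prop]
  constructor
  · rintro ⟨a, haA, ha⟩
    by_cases haΛ : a ∈ Λ
    · refine ⟨⟨a, haΛ⟩, haA, ?_⟩
      have := (Set.ext_iff.1 (liftEdges_preimage_openConn Λ ho haΛ) ω).1 ha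
      exact this
    · -- `a ∉ Λ` is not reachable from `o ∈ Λ` unless `a = o`
      exfalso
      obtain ⟨w⟩ := ha
      have key : ∀ (u v : Site d) (_ : (openGraph (liftEdges Λ ω)).Walk u v), u ∈ Λ → v ∈ Λ := by
        intro u v wk
        induction wk with
        | nil => exact id
        | @cons a b c hab _ ih =>
          intro _
          rw [openGraph_adj] at hab
          obtain ⟨⟨e', _, hee'⟩, _⟩ := hab
          apply ih
          have hb : b ∈ Sym2.map Subtype.val e' := by rw [hee']; exact Sym2.mem_mk_right a b
          obtain ⟨y, -, hy⟩ := Sym2.mem_map.1 hb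
          rw [← hy]; exact y.2
      exact haΛ (key o a w ho)
  · rintro ⟨a', haA, ha⟩
    refine ⟨a', haA, ?_⟩
    have := (Set.ext_iff.1 (liftEdges_preimage_openConn Λ ho a'.2) ω).2 ha
    exact this

/-- **The FK set-target gluing (p243470) for the transplant's law, with relays reliable INSIDE a region**: for
`1 ≤ q`, a finite piece `Λ ∋ o`, relays `A`, a target set `T`, and a slack `t ≥ 0` with
`φ(a ↔ T inside Rg) ≥ 1 - t` for all `a ∈ A`: `φ(o ↔ T) ≥ φ(o ↔ A) - t`, `φ = fkLaw Λ w q` (reliability inside `Rg`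
implies plain reliability; then `FK.setTarget_additiveGluing_rc` on `↥Λ` through `liftEdges`).
[cite: KozmaNitzan2024, Conj. 3 (p. 15), p. 22 l. 1–4; Grimmett2006, §1.4 eq. (1.20)] -/
theorem fkLaw_setTarget_gluing_in {q : ℝ} (hq : 1 ≤ q) (Λ : Finset (Site d)) (w : Sym2 (Site d) → unitInterval)
    (A T : Finset (Site d)) {o : Site d} (ho : o ∈ Λ) (Rg : Set (Site d))
    {t : ℝ} (ht : 0 ≤ t) (hrel : ∀ a ∈ A, 1 - t ≤ (fkLaw Λ w q).real (⋃ s ∈ T, openConnIn Rg a s)) :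
    (fkLaw Λ w q).real (⋃ a ∈ A, openConn o a) - t ≤ (fkLaw Λ w q).real (⋃ s ∈ T, openConn o s) := by
  haveI : Countable (Site d) := inferInstance
  set w' : Sym2 ↥Λ → unitInterval := fun e => w (Sym2.map Subtype.val e) with hw'
  set A' : Finset ↥Λ := Finset.univ.filter fun a' => (a' : Site d) ∈ A with hA'
  set T' : Set ↥Λ := {s' | (s' : Site d) ∈ T} with hT'
  have hmA : MeasurableSet (⋃ a ∈ A, openConn o a : Set (BondConfig (Site d))) :=
    Finset.measurableSet_biUnion _ fun a _ => measurableSet_openConn_holds _ _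
  have hmT : ∀ x : Site d, MeasurableSet (⋃ s ∈ T, openConn x s : Set (BondConfig (Site d))) := fun x =>
    Finset.measurableSet_biUnion _ fun s _ => measurableSet_openConn_holds _ _
  have hoA : (fkLaw Λ w q).real (⋃ a ∈ A, openConn o a) = (rcMeasureW w' q ∅).real (⋃ a' ∈ A', openConn (⟨o, ho⟩ : ↥Λ) a') := by
    rw [fkLaw_real_apply Λ w q hmA, liftEdges_preimage_biUnion_openConn Λ ho]
    congr 1
    ext ω; simp [hA']
  have hxT : ∀ {x : Site d} (hx : x ∈ Λ), (fkLaw Λ w q).real (⋃ s ∈ T, openConn x s) =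
      (rcMeasureW w' q ∅).real (⋃ s' ∈ T', openConn (⟨x, hx⟩ : ↥Λ) s') := by
    intro x hx
    rw [fkLaw_real_apply Λ w q (hmT x), liftEdges_preimage_biUnion_openConn Λ hx]
  have hrel' : ∀ a' ∈ A', 1 - t ≤ (rcMeasureW w' q ∅).real (⋃ s' ∈ T', openConn a' s') := by
    intro a' ha'
    have haA : (a' : Site d) ∈ A := (Finset.mem_filter.1 ha').2
    have h := hrel _ haA
    have hmono : (⋃ s ∈ T, openConnIn Rg (a' : Site d) s : Set (BondConfig (Site d))) ⊆ ⋃ s ∈ T, openConn (a' : Site d) s := by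
      intro ω hω
      simp only [Set.mem_iUnion, exists_prop] at hω ⊢
      obtain ⟨s, hs, h⟩ := hω
      refine ⟨s, hs, ?_⟩
      rw [DCT16.mem_openConnIn_iff_pathIn] at h
      exact reachable_of_pathIn h
    haveI := isProbabilityMeasure_fkLaw Λ w (one_pos.trans_le hq)
    have := h.trans (measureReal_mono hmono (measure_ne_top _ _))
    rwa [hxT a'.2] at this
  have key := setTarget_additiveGluing_rc hq w' A' T' ⟨o, ho⟩ ht hrel'
  rwa [← hoA, ← hxT ho] at key

/-! ### Lemma 10 for `fkLaw`, `q ≥ 1`, `P_{p̃}`-hittable geometries -/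

/-- **Kozma–Nitzan's target lemma (Lemma 10) for the random-cluster law `fkLaw Λ W q`, `q ≥ 1`, in the Bernoulli
window, for `P_{p̃}`-hittable geometries.** Let `0 < p < 1`, `1 ≤ q`, and `p̃ < 1` a comparison density with
`p̃·q·(1-p) ≤ p·(1-p̃)` and `θ(p̃) > 0`. For every `ε > 0` there is `δ > 0` such that for every finite family `H`
of `P_{p̃}`-hittable geometries there is `R` with `FKTargetAt d q p δ ε H R`: for every finitely supported
weighting `W` on `Sfin` with a lattice subbox `D ⊇ B⟨R⟩` at `p`, every nonempty target `T ⊆ D` w.r.t. `(B, D, R, H)`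
and every source `o ∉ D`, `φ(o ↔ B) > 1 - δ ⟹ φ(o ↔ T) > 1 - ε`, `φ = fkLaw Sfin W q`. Proof = KN pp. 17–22 with:
Conjecture 3 ↦ FK set-target gluing (`fkLaw_setTarget_gluing_in`); Steps II–III ↦ the law-generic seeds engine
with FK finite energy (`KNFree.exists_level_real_Gev_gt`); Step IV ↦ `stepIV_in_fkLaw_of_comparison` (looks under
`P_{p̃}`: Lemma 7 `exists_forall_le_lt_real_uniqZone`, Lemma 9 `exists_forall_lt_real_linked_orthantFace`,
hittability); Step V ↦ `stepV_in_fkLaw` (exchange inequality).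
[cite: KozmaNitzan2024, §4 Lemma 10 (pp. 17–22); Grimmett2006, Thm. (3.7), Thm. (3.21) eq. (3.23), Thm. (3.1) eq. (3.4)] -/
theorem fkTargetAt_of_isHittable_comparison [NeZero d] {q : ℝ} (hq : 1 ≤ q) (p p' : unitInterval)
    (hp0 : 0 < (p : ℝ)) (hp1 : (p : ℝ) < 1) (hcmp : (p' : ℝ) * (q * (1 - p)) ≤ (p : ℝ) * (1 * (1 - p')))
    (hθ : 0 < theta (zdGraph d) 0 p') (hp'1 : (p' : ℝ) < 1) {ε : ℝ} (hε : 0 < ε) :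
    ∃ δ : ℝ, 0 < δ ∧ ∀ H : List (Geom d), (∀ g ∈ H, IsHittable p' g) → ∃ R : ℕ, FKTargetAt d q p δ ε H R := by
  classical
  have hq0 : 0 < q := one_pos.trans_le hq
  -- trivial when `ε > 1`
  rcases le_or_gt ε 1 with hε1 | hε1
  swap
  · refine ⟨1, one_pos, fun H _ => ⟨0, fun W Sfin D lo hi T o _ _ _ _ _ _ _ _ _ _ => ?_⟩⟩
    haveI := isProbabilityMeasure_fkLaw Sfin W hq0
    exact lt_of_lt_of_le (by linarith) measureReal_nonneg
  -- Step I: the constants `δ_{C3} = ε/4`, `δ`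
  set δc : ℝ := min (ε / 4) 1 with hδc
  have hδc0 : 0 < δc := lt_min (by positivity) one_pos
  have hδc1 : δc ≤ 1 := min_le_right _ _
  have hδc4 : δc ≤ ε / 4 := min_le_left _ _
  set δ : ℝ := ε * δc / 12 with hδdef
  have hδpos : 0 < δ := by positivity
  have hδc' : δ ≤ δc := by rw [hδdef]; nlinarith
  have h3δ : 3 * δ ≤ 1 := by rw [hδdef]; nlinarith
  have h12 : 12 * δ ≤ ε * δc := by rw [hδdef]; linarith
  have hδ1 : δ ≤ 1 := by linarith
  refine ⟨δ, hδpos, fun H hH => ?_⟩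
  -- the scales `m`, `M` (looks under `P_{p̃}`)
  have hη : 0 < δ ^ 2 := by positivity
  have hkl : ∀ g ∈ H, ∃ kl : ℕ × ℕ, ∀ m, kl.1 ≤ m → ∀ ℓ, kl.2 ≤ ℓ →
      1 - δ ^ 2 < (bondPercolation (zdGraph d) p').real (linkIn (↑(g.Qset ℓ 0)) (box d m) (g.Fset ℓ 0)) := by
    intro g hg
    obtain ⟨k, ℓ₀, h⟩ := (hH g hg).hit (δ ^ 2) hη
    exact ⟨(k, ℓ₀), h⟩
  choose! kl hklspec using hkl
  have le_foldr_max_of_mem : ∀ {l : List ℕ} {a : ℕ}, a ∈ l → a ≤ l.foldr max 0 := by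
    intro l
    induction l with
    | nil => intro a h; exact absurd h List.not_mem_nil
    | cons b l ih =>
      intro a h
      rw [List.foldr_cons]
      rcases List.mem_cons.1 h with rfl | h
      · exact le_max_left _ _
      · exact (ih h).trans (le_max_right _ _)
  set k₀ := (H.map fun g => (kl g).1).foldr max 0 with hk₀
  set ℓmax := (H.map fun g => (kl g).2).foldr max 0 with hℓmax
  have hk₀le : ∀ g ∈ H, (kl g).1 ≤ k₀ := fun g hg => le_foldr_max_of_mem (List.mem_map.2 ⟨g, hg, rfl⟩)
  have hℓle : ∀ g ∈ H, (kl g).2 ≤ ℓmax := fun g hg => le_foldr_max_of_mem (List.mem_map.2 ⟨g, hg, rfl⟩)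
  obtain ⟨m, hmk₀, n₁, hmn₁, hface⟩ := exists_forall_lt_real_linked_orthantFace p' hθ hp'1 hη k₀
  obtain ⟨n₂, huniq⟩ := exists_forall_le_lt_real_uniqZone p' m hη
  set M := max n₁ n₂ with hM
  have hmM : m ≤ M := (le_of_lt hmn₁).trans (le_max_left _ _)
  -- the number of seeds `k` (FK insertion constant `π = p/(p+q(1-p))`), of contacts `N`, of levels
  set π : ℝ := (p : ℝ) / (p + q * (1 - p)) with hπ
  have hden : 0 < (p : ℝ) + q * (1 - p) := by nlinarith [p.2.2]
  have hπ0 : 0 < π := div_pos hp0 hden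
  have hπ1 : π ≤ 1 := by rw [hπ, div_le_one hden]; nlinarith [p.2.2]
  set sM : ℕ := seedBound d M with hsM
  set qs : ℝ := 1 - π ^ sM with hqs
  have hqs0 : 0 ≤ qs := by rw [hqs, sub_nonneg]; exact pow_le_one₀ hπ0.le hπ1
  have hqs1 : qs < 1 := by rw [hqs]; linarith [pow_pos hπ0 sM]
  obtain ⟨k, hk⟩ := exists_pow_lt_of_lt_one hδpos hqs1
  set N := LData.Ncont d M k with hN
  set K₀ : ℝ := 1 / (1 - (p : ℝ)) ^ (2 * d * N) with hK₀
  set Lcount : ℕ := ⌈K₀ / δ⌉₊ + 1 with hLcount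
  set j₀ : ℕ := 2 * M + 2 with hj₀
  set j₁ : ℕ := j₀ + Lcount - 1 with hj₁
  set R : ℕ := j₁ + M + ℓmax + 2 with hR
  refine ⟨R, fun W Sfin D lo hi T o hfin hsub hDS ho hoD hBR htgt hTD hTne hreach => ?_⟩
  set μ := fkLaw Sfin W q with hμ
  haveI hμP : IsProbabilityMeasure μ := isProbabilityMeasure_fkLaw Sfin W hq0
  -- `lo ≤ hi`, else `B = ∅`
  have hlohi : lo ≤ hi := by
    by_contra hlt
    have : Finset.Icc lo hi = ∅ := Finset.Icc_eq_empty hlt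
    rw [this] at hreach
    simp only [Finset.notMem_empty, Set.iUnion_of_empty, Set.iUnion_empty, measureReal_empty] at hreach
    linarith
  -- the level data and hypotheses
  set L : LData d := ⟨lo, hi, o, Sfin⟩ with hLdef
  have hL : LHyp L W p D (R - 1) :=
    { sub := hsub
      fin := hfin
      DS := hDS
      encl := by
        have : R - 1 + 1 = R := by omega
        rw [this]; exact hBR
      o_not := hoD
      o_mem := ho }
  -- Steps II–III for `fkLaw`: the three tolerance hypotheses of the engine
  have hWΛ : ∀ F : Finset (Sym2 (Site d)), (∀ e ∈ F, W e = p) → ∀ e ∈ F, ∀ z ∈ e, z ∈ Sfin := by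
    intro F hF e he z hz
    refine KNFree.forall_mem_of_finSupp hfin (fun h0 => ?_) z hz
    have : ((W e : unitInterval) : ℝ) = 0 := by rw [h0]; rfl
    rw [hF e he] at this
    exact hp0.ne' this
  have hnull : μ.real (LData.PosOnly W)ᶜ = 0 := KNFree.real_fkLaw_compl_posOnly_eq_zero hq Sfin W
  have hdel : ∀ (F : Finset (Sym2 (Site d))) (A : Set (BondConfig (Site d))), (∀ e ∈ F, W e = p) → MeasurableSet A →
      (1 - (p : ℝ)) ^ F.card * μ.real ((fun ω => ω \ ↑F) ⁻¹' A) ≤ μ.real A :=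
    fun F A hF hA => KNFree.del_tolerance_fkLaw hq Sfin W hF (hWΛ F hF) hA
  have hins : ∀ (F : Finset (Sym2 (Site d))) (A : Set (BondConfig (Site d))), (∀ e ∈ F, W e = p) → MeasurableSet A →
      π ^ F.card * μ.real ((fun ω => ω ∪ ↑F) ⁻¹' A) ≤ μ.real A :=
    fun F A hF hA => KNFree.ins_tolerance_fkLaw hq Sfin W hF (hWΛ F hF) hA
  have hj₁R : j₁ ≤ R - 1 := by omega
  have hcard : ((Finset.Icc j₀ j₁).card : ℝ) = Lcount := by
    rw [Nat.card_Icc]; congr 1; omega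
  have hJ : 1 / (1 - (p : ℝ)) ^ (2 * d * N) ≤ δ * ((Finset.Icc j₀ j₁).card : ℝ) := by
    rw [hcard, hLcount]
    push_cast
    have h1 : K₀ / δ ≤ ⌈K₀ / δ⌉₊ := Nat.le_ceil _
    have h2 : K₀ = δ * (K₀ / δ) := by field_simp
    rw [← hK₀]
    nlinarith
  have hwideJ : ∀ j ∈ Finset.Icc j₀ j₁, ∀ i, L.Lo j i + 2 * M + 2 ≤ L.Hi j i := by
    intro j hj i
    have hj₀j := (Finset.mem_Icc.1 hj).1
    simp only [LData.Lo, LData.Hi, Pi.sub_apply, Pi.add_apply, Pi.natCast_apply]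
    have : L.lo i ≤ L.hi i := hlohi i
    omega
  obtain ⟨j, hjJ, hG⟩ := KNFree.exists_level_real_Gev_gt μ hL hπ0.le hπ1 hnull hdel hins hp1 hj₁R hwideJ hJ hk.le hreach
  obtain ⟨hj₀j, hjj₁⟩ := Finset.mem_Icc.1 hjJ
  have hjR : j ≤ R - 1 := hjj₁.trans hj₁R
  have hjM : 2 * M + 2 ≤ j := hj₀j
  have hwide : ∀ k', L.Lo j k' + 2 * M + 2 ≤ L.Hi j k' := hwideJ j hjJ
  -- the shell
  set S := L.X (j - 1) \ L.X (j - (2 * M + 2)) with hSdef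
  have hS : S ⊆ Finset.Icc (L.Lo j + 1) (L.Hi j - 1) := LData.shell_subset_shrink (by omega)
  have hSD : S ⊆ D := (Finset.sdiff_subset).trans (hL.X_subset_D (by omega))
  -- the faces lie in the shell
  have hUS : ∀ x ∈ outerBoundary (zdGraph d) (L.X j), L.ufaceX j M x ⊆ S := by
    intro x hx
    obtain ⟨h, -⟩ := LData.winData_spec hwide hx
    refine (uface_subset_cube h).trans ?_
    change L.cubeX j M x ⊆ S
    rw [LData.cubeX_eq_ball]
    exact LData.ball_vX_subset_shell hjM hwide hx
  -- Step IV at every contact vertex, by comparison with `P_{p̃}` on `D`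
  set V := restrW (↑D : Set (Site d)) (lattW d p') with hV
  have hsubV : IsSubbox V p' D := isSubbox_restrW_lattW D p'
  have hIV : ∀ x ∈ outerBoundary (zdGraph d) (L.X j),
      1 - 3 * δ ≤ (fkLaw Sfin (restrW (↑S : Set (Site d)) W) q).real {ω | ∃ u ∈ L.ufaceX j M x,
        1 - δ < (fkLaw Sfin (pinW W (wireSet (↑S : Set (Site d))) ω) q).real
          (⋃ t ∈ T, openConnIn (↑D : Set (Site d)) u t)} := by
    intro x hx
    set v := L.vX j M x with hv
    have hballS : GM.ball v M ⊆ S := LData.ball_vX_subset_shell hjM hwide hx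
    have hballD : (↑(GM.ball v M) : Set (Site d)) ⊆ ↑D := Finset.coe_subset.2 (hballS.trans hSD)
    -- the target route from `v`
    have hvB : v ∈ Finset.Icc (lo - (R : Site d)) (hi + (R : Site d)) := by
      have := LData.vX_mem (L := L) (by omega) hwide hx
      exact Icc_enlarge_mono (show j - 1 ≤ R by omega) this
    obtain ⟨ℓ, hRℓ, g, hg, hQ, hF⟩ := htgt.hit v hvB
    have hMℓ : M < ℓ := lt_of_lt_of_le (by omega) hRℓ
    -- (1) uniqueness zone under `P_{p̃}` (Lemma 7)
    have h1 : 1 - δ ^ 2 < (prodBernoulli V).real (uniqZoneAt v m M) := by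
      rw [hsubV.real_eq_bondPercolation (determinedBy_uniqZoneAt v m M (wireSet_mono hballD))
        (measurableSet_uniqZoneAt v m M), real_uniqZoneAt_eq]
      exact huniq M (le_max_right _ _)
    -- (2) the face under `P_{p̃}` (Lemma 9)
    have h2 : 1 - δ ^ 2 < (prodBernoulli V).real (linkIn (↑(GM.ball v M)) (GM.ball v m) (L.ufaceX j M x)) := by
      obtain ⟨a, τ, hsubU⟩ := LData.orthantFace_image_subset_ufaceX hwide hx
      have hmono : linkIn (↑(GM.ball v M)) (GM.ball v m) ((orthantFace a τ M).image (· + v)) ⊆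
          linkIn (↑(GM.ball v M)) (GM.ball v m) (L.ufaceX j M x) := linkIn_mono le_rfl le_rfl hsubU
      refine lt_of_lt_of_le ?_ (measureReal_mono hmono (measure_ne_top _ _))
      rw [hsubV.real_eq_bondPercolation (determinedBy_linkIn _ _ _ (wireSet_mono hballD))]
      · have e1 : GM.ball v M = (box d M).image (· + v) := rfl
        have e2 : GM.ball v m = (box d m).image (· + v) := rfl
        rw [e1, e2, real_linkIn_image_add]
        exact hface M (le_max_left _ _) a τ
      · exact measurableSet_linkIn _ _ _
    -- (3) the target route under `P_{p̃}` (hittability at `p̃`)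
    have h3 : 1 - δ ^ 2 < (prodBernoulli V).real (linkIn (↑(g.Qset ℓ v)) (GM.ball v m) (g.Fset ℓ v)) := by
      rw [hsubV.real_eq_bondPercolation (determinedBy_linkIn _ _ _ (wireSet_mono (Finset.coe_subset.2 hQ)))
        (measurableSet_linkIn _ _ _)]
      have e2 : GM.ball v m = (box d m).image (· + v) := rfl
      rw [g.Qset_eq_image ℓ v, g.Fset_eq_image ℓ v, e2, real_linkIn_image_add]
      exact hklspec g hg m ((hk₀le g hg).trans hmk₀) ℓ ((hℓle g hg).trans (by omega))
    exact stepIV_in_fkLaw_of_comparison (Λ := Sfin) hq hsub hDS hSD hcmp hF hQ hmM hballS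
      (LData.ufaceX_subset_innerBoundary hwide hx) (g.disjoint_Fset_ball hMℓ v) hδpos
      (Rg := (↑D : Set (Site d))) hballD (Finset.coe_subset.2 hQ) h1 h2 h3
  -- the gluing hypothesis: source `o ∉ D`, relays reliable to `T` inside `D`
  have hC3' : ∀ (w : Sym2 (Site d) → unitInterval), FinSupp w L.Sfin → ∀ (A : Finset (Site d)), A ⊆ L.Sfin →
      1 - δc < (fkLaw Sfin w q).real (⋃ a ∈ A, openConn L.o a) →
      (∀ a ∈ A, 1 - δc < (fkLaw Sfin w q).real (⋃ t ∈ T, openConnIn (↑D : Set (Site d)) a t)) →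
      1 - ε / 2 < (fkLaw Sfin w q).real (⋃ t ∈ T, openConn L.o t) := by
    intro w _ A _ hoA haT
    have key := fkLaw_setTarget_gluing_in hq Sfin w A T ho (↑D : Set (Site d)) hδc0.le fun a ha => (haT a ha).le
    change 1 - δc < (fkLaw Sfin w q).real (⋃ a ∈ A, openConn o a) at hoA
    change 1 - ε / 2 < (fkLaw Sfin w q).real (⋃ t ∈ T, openConn o t)
    linarith
  -- Step V
  exact stepV_in_fkLaw hL hq hp0 (Λ := Sfin) subset_rfl (Rg := (↑D : Set (Site d))) hjR hwide hS hSD hε hε1 hδpos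
    hδc' h3δ h12 hG hUS hIV hC3'


/-! ### The Bernoulli window `θ(p̃) > 0`, `p̃ = p/(p + q(1-p))` -/

/-- **KN Lemma 10 for `fkLaw`, `q ≥ 1`, in the Bernoulli window** (comparison density `p̃ = p/(p+q(1-p))`): for
`0 < p < 1` with `θ(p̃) > 0`, every `ε > 0` has a `δ > 0` such that every finite family of `P_{p̃}`-hittable
geometries admits an `R` with `FKTargetAt d q p δ ε H R`. [cite: KozmaNitzan2024, §4 Lemma 10 (pp. 17–22); Grimmett2006, Thm. (3.21) eq. (3.23)] -/
theorem fkTargetAt_of_isHittable_ratio [NeZero d] {q : ℝ} (hq : 1 ≤ q) (p : unitInterval)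
    (hp0 : 0 < (p : ℝ)) (hp1 : (p : ℝ) < 1)
    (hθ : 0 < theta (zdGraph d) 0 ⟨(p : ℝ) / (p + q * (1 - p)), ratio_mem_Icc p.2 hq⟩) {ε : ℝ} (hε : 0 < ε) :
    ∃ δ : ℝ, 0 < δ ∧ ∀ H : List (Geom d),
      (∀ g ∈ H, IsHittable (⟨(p : ℝ) / (p + q * (1 - p)), ratio_mem_Icc p.2 hq⟩ : unitInterval) g) →
        ∃ R : ℕ, FKTargetAt d q p δ ε H R :=
  fkTargetAt_of_isHittable_comparison hq p _ hp0 hp1 (ratio_cond_density p.2 hq) hθ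
    ((ratio_le_self p.2 hq).trans_lt hp1) hε

/-- **The FK target inequality for Kozma–Nitzan's quarter-face geometries holds in the Bernoulli window, for every
`q ≥ 1` and `d ≥ 2`**: for `0 < p < 1` with `θ(p̃) > 0`, `p̃ = p/(p+q(1-p))`, every `ε > 0` has a `δ > 0` such that
every sub-family `H` of the quarter faces `qfList d` (KN Lemma 9's `H`; `P_{p̃}`-hittable by the tree's Lemma 9 at
`p̃`, via T1's `isHittable_of_fh` ∘ `fh_one_of_theta_pos`) admits an `R` with `FKTargetAt d q p δ ε H R`. Together
with T1 (`fh_of_theta_ratio_pos`: `FH d q p` in the same window) this is what the comparison method yields for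
the two OPEN binders of the record; the binder `KNFreeTargetHittable d q p` itself (ALL FK(p,q)-hittable `H`) is
NOT reached (a 2-dimensional sheet geometry can be FK(p,q)-hittable and not `P_{p̃}`-hittable).
[cite: KozmaNitzan2024, §4 Lemma 9 (p. 16), Lemma 10 (pp. 17–22); Grimmett2006, Thm. (3.21) eq. (3.23)] -/
theorem fkTargetAt_qfList_of_theta_ratio_pos [NeZero d] (hd : 2 ≤ d) {q : ℝ} (hq : 1 ≤ q) (p : unitInterval)
    (hp0 : 0 < (p : ℝ)) (hp1 : (p : ℝ) < 1)
    (hθ : 0 < theta (zdGraph d) 0 ⟨(p : ℝ) / (p + q * (1 - p)), ratio_mem_Icc p.2 hq⟩) {ε : ℝ} (hε : 0 < ε) :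
    ∃ δ : ℝ, 0 < δ ∧ ∀ H : List (Geom d), (∀ g ∈ H, g ∈ qfList d) → ∃ R : ℕ, FKTargetAt d q p δ ε H R := by
  obtain ⟨δ, hδ, h⟩ := fkTargetAt_of_isHittable_ratio hq p hp0 hp1 hθ hε
  refine ⟨δ, hδ, fun H hH => h H fun g hg => ?_⟩
  have hp'1 : ((⟨(p : ℝ) / (p + q * (1 - p)), ratio_mem_Icc p.2 hq⟩ : unitInterval) : ℝ) < 1 :=
    (ratio_le_self p.2 hq).trans_lt hp1
  exact isHittable_of_fh le_rfl (fh_one_of_theta_pos hd _ hθ hp'1) g (hH g hg)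

end Summit.CriticalPhenomena.PercolationContinuityZ3.Theorems.FK

end
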